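import Summits.RiemannHypothesis.RiemannHypothesis.Theorems.LiPrimeEchoLawProof
import Summits.RiemannHypothesis.RiemannHypothesis.Theorems.LiPrimeEchoSmoothWindowBound
import HarnessLib

/-!
# RiemannHypothesis / LiPrimeEcho — the BARE window echo is a theorem (RH-FREE PROOF-OF-DATA)

RH-FREE [rh-li-eng-4].  Cell `pub/rh-li`; PART D (`Theorems/LiPrimeEchoDefs.lean`) companion `LiZeroWindowEchoBare` (T3d⁻):
«the zeros of height `(√n, c√n]` ALONE chirp the prime `2`» — for `c ≥ 5/4`,
`|Σ_{√n<|Im ρ|≤c√n} Re m_ρ(1 − 1/ρ)ⁿ + E₂(n)| ≤ C_c log² n`.  It follows from the PROVED rung leaf «Li PRIME-ECHO LAW»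
`liZeroWindowEcho_proof` (route LiPrimeEcho, CLOSED·proved) and the smooth window bound `liSmoothTraceWindowBound_holds`
(`Theorems/LiPrimeEchoSmoothWindowBound.lean`): the smooth counterpart `(2/π)∫_{√n}^{c√n} cos(nθ)ϑ'` is itself `O_c(log n)`.
DATA it explains: kit j241673 / j247551 (DATA.md §F/§G: the window sums of the zeros alone fit `−A₂ n^{1/4} cos(2√(n log 2) + π/4)`
with amplitude 0.3639 vs `A₂ = 0.3640`).  Nothing here bears on the truth of RH: every zero of the window is summed
whatever its real part; not RH-sensitive, not a positivity statement.
-/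

noncomputable section

-- D-0017: `Summit.<S>.<S>.…` is the designed namespace of a single-problem summit.
set_option linter.dupNamespace false

namespace Summit.RiemannHypothesis.RiemannHypothesis.Theorems.LiTheory

/-- **BARE WINDOW ECHO (PART D companion `LiZeroWindowEchoBare`, T3d⁻) holds — RH-FREE PROOF-OF-DATA:** for `c ≥ 5/4`
the zeros of height `(√n, c√n]` ALONE, Li-weighted and summed whatever their real parts, chirp the prime `2`:
`|liZeroTraceWindow n √n (c√n) + E₂(n)| ≤ C log² n` (PROVED leaf `liZeroWindowEcho_proof` + the smooth window bound). -/
theorem liZeroWindowEchoBare_holds : LiZeroWindowEchoBare := by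
  intro c hc
  obtain ⟨C₁, hC₁⟩ := liZeroWindowEcho_proof c hc
  obtain ⟨C₂, hC₂⟩ := liSmoothTraceWindowBound_holds c (by linarith)
  refine ⟨C₁ + |C₂| / Real.log 2, fun n hn ↦ ?_⟩
  have h2 : 0 < Real.log 2 := Real.log_pos (by norm_num)
  have hlog : Real.log 2 ≤ Real.log n := Real.log_le_log (by norm_num) (by exact_mod_cast hn)
  have hlogpos : 0 < Real.log n := h2.trans_le hlog
  have hA := hC₁ n hn
  have hB := hC₂ n hn
  have hB' : |liSmoothTraceWindow n (Real.sqrt n) (c * Real.sqrt n)| ≤ |C₂| / Real.log 2 * Real.log n ^ 2 := by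
    calc |liSmoothTraceWindow n (Real.sqrt n) (c * Real.sqrt n)| ≤ C₂ * Real.log n := hB
      _ ≤ |C₂| * Real.log n := mul_le_mul_of_nonneg_right (le_abs_self _) hlogpos.le
      _ = |C₂| / Real.log 2 * (Real.log 2 * Real.log n) := by field_simp
      _ ≤ |C₂| / Real.log 2 * (Real.log n * Real.log n) := by
          apply mul_le_mul_of_nonneg_left _ (by positivity)
          exact mul_le_mul_of_nonneg_right hlog hlogpos.le
      _ = |C₂| / Real.log 2 * Real.log n ^ 2 := by ring
  calc |liZeroTraceWindow n (Real.sqrt n) (c * Real.sqrt n) + liPrimeEcho 2 n|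
        = |(liZeroTraceWindow n (Real.sqrt n) (c * Real.sqrt n)
            - liSmoothTraceWindow n (Real.sqrt n) (c * Real.sqrt n) + liPrimeEcho 2 n)
            + liSmoothTraceWindow n (Real.sqrt n) (c * Real.sqrt n)| := by ring_nf
    _ ≤ |liZeroTraceWindow n (Real.sqrt n) (c * Real.sqrt n)
            - liSmoothTraceWindow n (Real.sqrt n) (c * Real.sqrt n) + liPrimeEcho 2 n|
          + |liSmoothTraceWindow n (Real.sqrt n) (c * Real.sqrt n)| := abs_add_le _ _
    _ ≤ C₁ * Real.log n ^ 2 + |C₂| / Real.log 2 * Real.log n ^ 2 := add_le_add hA hB'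
    _ = (C₁ + |C₂| / Real.log 2) * Real.log n ^ 2 := by ring

end Summit.RiemannHypothesis.RiemannHypothesis.Theorems.LiTheory

end
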